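/-
Copyright (c) 2026 the pub-hodgecm-mathlib formalisation cell (harness21).  Prover seat hodgecm-mathlib-LH10-p02 (g14), 2026-09-03.  E1 row 55 «HOROCYCLE ∕ HEIGHT
GEOMETRY OF THE U(3) TREE AT THE DATUM», file B-3a «BOREL DOUBLE COSETS AT THE SPECIAL VERTICES» (keeper F0P3a-p03 (g30); consumer census `CENSUS-R61.v1` §2 (X3)(X4)).
-/
import Summits.HodgeConjecture.HodgeConjecture.Theorems.F0P3cStCharTSHorocyclesAtDatum   -- ★ B-1 (this seat): transport, (X0) `τ`, `T ∩ Stab(A 0)`, (X1v)(X1e) horocycle index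
import Literature.NumberTheory.Automorphic.UnitaryLatticeTreeOrbitsViaApartment          -- ★ A-III p853494 (LH5-p05): the two `U`-orbits of vertices, `w₀ · A j = A (−j)`
import HarnessLib

/-!
# F0 · P3c · E1 row 55 — THE BOREL DOUBLE COSETS OF `U(3)(L⁺_v)` AT THE TWO SPECIAL VERTICES: `Γ = B · Stab(A 0) = B · Stab(A 1)` and `B ∩ Stab(A m) = (T ∩ Stab(A 0)) · (N ∩ Stab(A m))`
# (Bruhat–Tits 1972 (4.4.3)–(4.4.4), §10; Rogawski 1990 §1.10, §4.5; Schneider–Stuhler 1997 §III.4)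

Cell `pub/hodgecm-mathlib`, crux H413 = `stmt-HodgeConjecture-24833` (`--supports` lane, helper, THEOREMS ONLY: no definition ∕ instance ∕ notation ∕ named fact ∕ `sorry`).
Namespace `Summit.HodgeConjecture.HodgeConjecture.Cruxes.H413.F0P3cStCharTSHorocyclesAtDatum` (continued).  E1 BRICK LEDGER row 55 (keeper F0P3a-p03 (g30)), file B-3a of the datum
side = the GEOMETRIC binders `hcover hdisj hT hdec hC` of ★ (α) `Representation.finrank_intertwiningMap_smoothIndRep_eq_sum_finrank_eigen` (`SchneiderStuhlerEPInducedTraceMackey` §5)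
at the two VERTEX types (`K := Stab(A 0)`, `K := Stab(A 1)`; `ι := Unit`, `g := 1`); the EDGE type (`K := Stab{A 0, A 1}`, `ι := Fin 2`, `g := (1, τ w₀)`) is file B-3b.  Currency:
★ B-1's (`Γ := Gqs L v`, `eA ∕ heA`, `a ∕ ha`, apartment `(A, hA0, hA1)`), with the Borel triple HYPOTHESIS-STYLE `(t : ParabolicTriple (Gqs L v)) (ht : t = cmBorelTriple L 3 v)` (so that
`H := t.P`, `↥t.P`, `t.M ⊓ P₀`, `t.N.subgroupOf _` are typed over `Gqs L v` exactly as ★ (α) wants them; the consumer passes `t := cmBorelTriple L 3 v, ht := rfl`) and the torus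
translation `(τM) (hτM : τM ∈ t.M) (hτA : ∀ j, a τM (A j) = A (j + 2))` of ★ B-1 (X0).  HONEST LABEL: count-neutral datum helper ((R-SS) banked as a PAYDOWN-UNR road for K1 only;
E1 = PRINT); HC_CM is proved only modulo the 7 printed citations (2 remaining named inputs hLiu418 = `stmt-HodgeConjecture-24832`, h413 = `stmt-HodgeConjecture-24833`) until rung 0 closes.

* §5.0 bookkeeping: `actionHom_mul_apply ∕ _one_apply ∕ _inv_apply_eq`; `actionHom_zpow_apartmentEnum` (`τM^c · A k = A (k + 2c)`); **`exists_mem_N_forall_apartmentEnum_eq_of_mem_P`**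
  (a Borel element translates the apartment by an EVEN amount modulo `N`: `b · A k = n · A (k + 2c₀)` for all `k`).
* §5.1 **`exists_mem_P_mul_of_apply_apartmentEnum (hm : m = 0 ∨ m = 1)`** (`Γ = B · Stab(A m)`: Iwasawa at both special vertices, via the horocycle index and the parity of
  the two `U`-orbits ★ A-III), **`exists_torus_mul_unipotent_of_mem_P_of_apply_apartmentEnum`** (`B ∩ Stab(A m) = (T ∩ Stab(𝒜)) · (N ∩ Stab(A m))`, ★ A-II (H8) along `eA`),
  `isCompact_subgroupOf_M_inf`, and the PACKAGE **`borelDoubleCoset_vertex (hm) (P₀ Pm) (hP₀) (hPm) : hcover ∧ hdisj ∧ hT ∧ hdec ∧ hC`** with `T := t.P ⊓ Pm`,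
  `C := (t.M ⊓ P₀).subgroupOf (t.P ⊓ Pm)`, `N := t.N.subgroupOf (t.P ⊓ Pm)`.

## References
* [BruhatTits1972] F. Bruhat, J. Tits, *Groupes réductifs sur un corps local I*, Publ. Math. IHÉS 41 (1972), (4.4.3) (Iwasawa), (4.4.4), §10.
* [Rogawski1990] J. D. Rogawski, *Automorphic Representations of Unitary Groups in Three Variables*, Ann. of Math. Stud. 123 (1990), §1.10 p. 9, §4.5 p. 45.
* [Serre1980Trees] J.-P. Serre, *Trees* (1980), Ch. II §1.1, Ch. I §6.4.
* [SchneiderStuhler1997] P. Schneider, U. Stuhler, *Representation theory and sheaves on the Bruhat–Tits building*, Publ. Math. IHÉS 85 (1997), §III.4 (Lemma III.4.13).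
-/

set_option autoImplicit false
-- the mandated namespace has the single-problem summit's repeated segment (`HodgeConjecture.HodgeConjecture`)
set_option linter.dupNamespace false

noncomputable section

open NumberField IsDedekindDomain
open scoped Valued WithZero Matrix MatrixGroups
open Literature.NumberTheory.Rogawski1990 Literature.NumberTheory.Automorphic Literature.NumberTheory.Automorphic.UnitaryGroup
open Literature.NumberTheory.Automorphic.UnitaryLatticeTree Literature.NumberTheory.Automorphic.HermitianLattice

namespace Summit.HodgeConjecture.HodgeConjecture.Cruxes.H413.F0P3cStCharTSHorocyclesAtDatum

/-! ## §5 THE BOREL DOUBLE COSETS AT THE THREE FACET TYPES (the geometric binders `hcover hdisj hT hdec hC` of ★ (α) `SchneiderStuhlerEPInducedTraceMackey` §5 at the datum):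
`Γ = B · Stab(A 0)`, `Γ = B · Stab(A 1)`, `Γ = B · Stab(e₀) ⊔ B · (τ w₀) · Stab(e₀)`; `B ∩ Stab(F) = (T ∩ Stab(A 0)) · (N ∩ Stab(F))` -/

section DoubleCoset

variable (L : Type) [Field L] [NumberField L] [IsCMField L] (v : HeightOneSpectrum (𝓞 ↥(maximalRealSubfield L)))
  (w : PlacesOver L v) (hw : IsCMField.complexConj L • w.1 = w.1) {ϖ : w.1.adicCompletion L}
  (hd : UnramifiedLocalConjDatum (galAdicCompletionMap (L := L) (IsCMField.complexConj L) hw) ϖ)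
  (eA : Gqs L v ≃ₜ* ↥(unitaryGroupOfForm (galAdicCompletionMap (L := L) (IsCMField.complexConj L) hw) ((StdForm.antidiagonal 3).over (w.1.adicCompletion L))))
  (heA : ∀ g : Gqs L v,
    ((eA g : ↥(unitaryGroupOfForm (galAdicCompletionMap (L := L) (IsCMField.complexConj L) hw) ((StdForm.antidiagonal 3).over (w.1.adicCompletion L)))) :
        GL (Fin 3) (w.1.adicCompletion L)) =
      ((localNonsplitEquiv (IsCMField.complexConj L) (qsForm L) (IsCMField.complexConj_ne_one L) w hw g :
        ↥(unitaryGroupOfForm (galAdicCompletionMap (L := L) (IsCMField.complexConj L) hw) (placeForm (qsForm L) w.1))) : GL (Fin 3) (w.1.adicCompletion L)))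
  {a : Gqs L v →* ((latticeGraph (galAdicCompletionMap (L := L) (IsCMField.complexConj L) hw) ϖ ((StdForm.antidiagonal 3).over (w.1.adicCompletion L))) ≃g
    (latticeGraph (galAdicCompletionMap (L := L) (IsCMField.complexConj L) hw) ϖ ((StdForm.antidiagonal 3).over (w.1.adicCompletion L))))}
  (ha : ∀ g, a g = latticeGraphIso (galAdicCompletionMap (L := L) (IsCMField.complexConj L) hw) ϖ ((StdForm.antidiagonal 3).over (w.1.adicCompletion L)) (eA g))
  (A : ℤ → {M : Submodule 𝒪[(w.1.adicCompletion L)] (Fin 3 → (w.1.adicCompletion L)) //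
    IsVertex (galAdicCompletionMap (L := L) (IsCMField.complexConj L) hw) ϖ ((StdForm.antidiagonal 3).over (w.1.adicCompletion L)) M})
  (hA0 : ∀ c : ℤ, (A (2 * c)).1 = latt (Matrix.diagonal ![ϖ ^ c, (1 : w.1.adicCompletion L), ϖ ^ (-c)]))
  (hA1 : ∀ c : ℤ, (A (2 * c + 1)).1 = latt (Matrix.diagonal ![ϖ ^ (c + 1), (1 : w.1.adicCompletion L), ϖ ^ (-c)]))
  (t : ParabolicTriple (Gqs L v)) (ht : t = cmBorelTriple L 3 v)
  (τM : Gqs L v) (hτM : τM ∈ t.M) (hτA : ∀ j : ℤ, a τM (A j) = A (j + 2))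

/-! ### §5.0 Bookkeeping: the action is multiplicative; `τM ^ c` translates by `2c`; Borel elements translate the apartment by an even amount modulo `N` -/

include ha in
/-- `a (g g') x = a g (a g' x)`. [cite: Serre1980Trees, II.1.1] -/
theorem actionHom_mul_apply (g g' : Gqs L v)
    (x : {M : Submodule 𝒪[(w.1.adicCompletion L)] (Fin 3 → (w.1.adicCompletion L)) //
      IsVertex (galAdicCompletionMap (L := L) (IsCMField.complexConj L) hw) ϖ ((StdForm.antidiagonal 3).over (w.1.adicCompletion L)) M}) :
    a (g * g') x = a g (a g' x) := by
  simp only [ha, map_mul, latticeGraphIso_mul_apply]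

include ha in
/-- `a 1 x = x`. [cite: Serre1980Trees, II.1.1] -/
theorem actionHom_one_apply
    (x : {M : Submodule 𝒪[(w.1.adicCompletion L)] (Fin 3 → (w.1.adicCompletion L)) //
      IsVertex (galAdicCompletionMap (L := L) (IsCMField.complexConj L) hw) ϖ ((StdForm.antidiagonal 3).over (w.1.adicCompletion L)) M}) :
    a 1 x = x := by
  simp only [ha, map_one, latticeGraphIso_one_apply]

include ha in
/-- `a g⁻¹` undoes `a g`. [cite: Serre1980Trees, II.1.1] -/
theorem actionHom_inv_apply_eq {g : Gqs L v}
    {x y : {M : Submodule 𝒪[(w.1.adicCompletion L)] (Fin 3 → (w.1.adicCompletion L)) //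
      IsVertex (galAdicCompletionMap (L := L) (IsCMField.complexConj L) hw) ϖ ((StdForm.antidiagonal 3).over (w.1.adicCompletion L)) M}}
    (h : a g x = y) : a g⁻¹ y = x := by
  rw [← h, ha, ha, map_inv, latticeGraphIso_inv_mul_apply]

include ha hτA in
set_option maxHeartbeats 800000 in  -- `congr`∕`rw` on the datum action (isDefEq on the CM carriers)
/-- **`τM ^ c` TRANSLATES THE APARTMENT BY `2c`**: `a (τM ^ c) (A k) = A (k + 2c)`. [cite: Serre1980Trees, I.6.4] [cite: BruhatTits1972, §10] -/
theorem actionHom_zpow_apartmentEnum (c k : ℤ) : a (τM ^ c) (A k) = A (k + 2 * c) := by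
  induction c using Int.induction_on generalizing k with
  | zero =>
    rw [zpow_zero, actionHom_one_apply L v w hw eA ha]
    congr 1; ring
  | succ i ih =>
    rw [zpow_add_one, actionHom_mul_apply L v w hw eA ha, hτA, ih]
    congr 1; ring
  | pred i ih =>
    have h1 : a τM⁻¹ (A k) = A (k - 2) := by
      have h := hτA (k - 2)
      rw [sub_add_cancel] at h
      have h2 := congrArg (a τM⁻¹) h
      rwa [← actionHom_mul_apply L v w hw eA ha, inv_mul_cancel, actionHom_one_apply L v w hw eA ha, eq_comm] at h2
    rw [zpow_sub_one, actionHom_mul_apply L v w hw eA ha, h1, ih]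
    congr 1; ring

include hd heA ha hA0 hA1 ht in
set_option maxHeartbeats 1600000 in  -- the datum vertex type (41g-H ∕ 48-datum `whnf` wall)
/-- **BOREL ELEMENTS TRANSLATE THE APARTMENT MODULO `N`**: for `b ∈ B(L⁺_v)` there are `n ∈ N(L⁺_v)` and `c₀ : ℤ` with `b · A k = n · A (k + 2c₀)` for ALL `k` (write `b = n′ m`,
`m = proj b ∈ T`, `n′ = b m⁻¹ ∈ N`; the torus part translates the apartment by an even amount, ★ A-II (H8₀)).  [cite: BruhatTits1972, §10] [cite: Rogawski1990, §1.10 p. 9] -/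
theorem exists_mem_N_forall_apartmentEnum_eq_of_mem_P {b : Gqs L v} (hb : b ∈ t.P) :
    ∃ n : Gqs L v, n ∈ t.N ∧ ∃ c₀ : ℤ, ∀ k : ℤ, a b (A k) = a n (A (k + 2 * c₀)) := by
  have hM : ∀ g : Gqs L v, g ∈ t.M ↔
      eA g ∈ torusU (galAdicCompletionMap (L := L) (IsCMField.complexConj L) hw) ((StdForm.antidiagonal 3).over (w.1.adicCompletion L)) :=
    fun g => by subst ht; exact mem_cmBorelTriple_M_iff L v w hw eA heA g
  set m : Gqs L v := ((t.proj ⟨b, hb⟩ : ↥t.M) : Gqs L v) with hm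
  have hmM : m ∈ t.M := (t.proj ⟨b, hb⟩).2
  have hn₁ : m⁻¹ * b ∈ t.N := t.proj_inv_mul_mem ⟨b, hb⟩
  have hn' : b * m⁻¹ ∈ t.N := by
    have hnorm := t.le_normalizer (t.M_le hmM)
    have h := (Subgroup.mem_normalizer_iff.1 hnorm (m⁻¹ * b)).1 hn₁
    rwa [mul_inv_cancel_left] at h
  obtain ⟨c₀, hshift, -⟩ := exists_forall_latticeGraphIso_apartmentEnum_eq_add_of_mem_torusU hd A hA0 hA1 ((hM m).1 hmM)
  refine ⟨b * m⁻¹, hn', c₀, fun k => ?_⟩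
  rw [← hshift k, ← ha, ← actionHom_mul_apply L v w hw eA ha, inv_mul_cancel_right]

/-! ### §5.1 `Γ = B · Stab(A m)` for `m ∈ {0, 1}` (one Borel double coset at each special vertex), and `B ∩ Stab(A m) = (T ∩ Stab(A 0)) · (N ∩ Stab(A m))` -/

include hd heA ha hA0 hA1 ht hτM hτA in
set_option maxHeartbeats 1600000 in  -- the datum vertex type (41g-H ∕ 48-datum `whnf` wall), as files B-1∕B-2
/-- **`Γ = B · Stab(A m)`** (`m = 0`: Iwasawa at the hyperspecial vertex; `m = 1`: at the other special vertex): every `y ∈ Gqs L v` is `h · κ` with `h ∈ B(L⁺_v)` and `κ` fixing `A m`.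
Proof: `x := y · A m` is `tr x · A (idx x)` (B-1 (X1v)); the parity of `idx x` is that of `m` (the two `U`-orbits of vertices, ★ A-III), so `A (idx x) = τM^c · A m` and
`h := tr x · τM^c`. [cite: BruhatTits1972, (4.4.3) and §10] [cite: Rogawski1990, §4.5 p. 45] [cite: Serre1980Trees, II.1.1] -/
theorem exists_mem_P_mul_of_apply_apartmentEnum {m : ℤ} (hm : m = 0 ∨ m = 1) (Pm : Subgroup (Gqs L v)) (hPm : ∀ g, g ∈ Pm ↔ a g (A m) = A m) (y : Gqs L v) :
    ∃ h : Gqs L v, h ∈ t.P ∧ ∃ κ ∈ Pm, y = h * κ := by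
  have hN : ∀ g : Gqs L v, g ∈ t.N ↔
      eA g ∈ unipotentU (galAdicCompletionMap (L := L) (IsCMField.complexConj L) hw) ((StdForm.antidiagonal 3).over (w.1.adicCompletion L)) :=
    fun g => by subst ht; exact mem_cmBorelTriple_N_iff L v w hw eA heA g
  obtain ⟨idx, tr, htrN, htr, -, -⟩ := exists_horocycleIndex_vertices L v w hw hd eA heA ha A hA0 hA1
  have htrN' : ∀ x, tr x ∈ t.N := fun x => (hN _).2 (by
    have h := htrN x; subst ht; exact (mem_cmBorelTriple_N_iff L v w hw eA heA _).1 h)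
  set x := a y (A m) with hx
  obtain ⟨c, hc⟩ : ∃ c : ℤ, idx x = 2 * c + m := by
    obtain ⟨c, hc | hc⟩ := Int.even_or_odd' (idx x)
    · rcases hm with rfl | rfl
      · exact ⟨c, by rw [hc, add_zero]⟩
      · -- `x` would lie in both vertex orbits
        exfalso
        refine not_exists_latticeGraphIso_apartmentEnum_zero_eq_and_one_eq hd A hA0 hA1 x ⟨⟨eA (tr x * τM ^ c), ?_⟩, ⟨eA y, ?_⟩⟩
        · rw [← ha, actionHom_mul_apply L v w hw eA ha, actionHom_zpow_apartmentEnum L v w hw eA ha A τM hτA c 0, zero_add, ← hc, htr]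
        · rw [← ha]
    · rcases hm with rfl | rfl
      · exfalso
        refine not_exists_latticeGraphIso_apartmentEnum_zero_eq_and_one_eq hd A hA0 hA1 x ⟨⟨eA y, ?_⟩, ⟨eA (tr x * τM ^ c), ?_⟩⟩
        · rw [← ha]
        · rw [← ha, actionHom_mul_apply L v w hw eA ha, actionHom_zpow_apartmentEnum L v w hw eA ha A τM hτA c 1, show (1 : ℤ) + 2 * c = 2 * c + 1 by ring, ← hc, htr]
      · exact ⟨c, hc⟩
  have hh : a (tr x * τM ^ c) (A m) = x := by
    rw [actionHom_mul_apply L v w hw eA ha, actionHom_zpow_apartmentEnum L v w hw eA ha A τM hτA c m, show m + 2 * c = 2 * c + m by ring, ← hc, htr]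
  refine ⟨tr x * τM ^ c, mul_mem (t.N_le (htrN' x)) (t.M_le (zpow_mem hτM c)), (tr x * τM ^ c)⁻¹ * y, ?_, by group⟩
  rw [hPm, actionHom_mul_apply L v w hw eA ha]
  exact actionHom_inv_apply_eq L v w hw eA ha hh

include hd heA ha hA0 hA1 ht in
/-- **`B ∩ Stab(A m) = (T ∩ Stab(A 0)) · (N ∩ Stab(A m))`** (★ A-II (H8) along `eA`): a Borel element fixing `A m` is `c · n` with `c ∈ T(L⁺_v)` fixing EVERY apartment vertex and
`n ∈ N(L⁺_v)` fixing `A m`. [cite: BruhatTits1972, §10] [cite: Rogawski1990, §1.10 p. 9] -/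
theorem exists_torus_mul_unipotent_of_mem_P_of_apply_apartmentEnum {b : Gqs L v} (hb : b ∈ t.P) {m : ℤ} (hbm : a b (A m) = A m) :
    ∃ c n : Gqs L v, c ∈ t.M ∧ (∀ k : ℤ, a c (A k) = A k) ∧ n ∈ t.N ∧ a n (A m) = A m ∧ b = c * n := by
  have hM : ∀ g : Gqs L v, g ∈ t.M ↔
      eA g ∈ torusU (galAdicCompletionMap (L := L) (IsCMField.complexConj L) hw) ((StdForm.antidiagonal 3).over (w.1.adicCompletion L)) :=
    fun g => by subst ht; exact mem_cmBorelTriple_M_iff L v w hw eA heA g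
  have hN : ∀ g : Gqs L v, g ∈ t.N ↔
      eA g ∈ unipotentU (galAdicCompletionMap (L := L) (IsCMField.complexConj L) hw) ((StdForm.antidiagonal 3).over (w.1.adicCompletion L)) :=
    fun g => by subst ht; exact mem_cmBorelTriple_N_iff L v w hw eA heA g
  have hP : ∀ g : Gqs L v, g ∈ t.P ↔
      eA g ∈ borelU (galAdicCompletionMap (L := L) (IsCMField.complexConj L) hw) ((StdForm.antidiagonal 3).over (w.1.adicCompletion L)) :=
    fun g => by subst ht; exact mem_cmBorelTriple_P_iff L v w hw eA heA g
  rw [ha] at hbm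
  obtain ⟨tt, n, httT, -, hnN, hbn, -, httA, hnA⟩ := exists_torusU_mul_unipotentU_of_mem_borelU_of_latticeGraphIso_apartmentEnum_eq hd A hA0 hA1 ((hP b).1 hb) hbm
  refine ⟨eA.symm tt, eA.symm n, (hM _).2 ?_, fun k => ?_, (hN _).2 ?_, ?_, ?_⟩
  · rw [ContinuousMulEquiv.apply_symm_apply]; exact httT
  · rw [ha, ContinuousMulEquiv.apply_symm_apply]; exact httA k
  · rw [ContinuousMulEquiv.apply_symm_apply]; exact hnN
  · rw [ha, ContinuousMulEquiv.apply_symm_apply]; exact hnA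
  · apply eA.injective; rw [map_mul, ContinuousMulEquiv.apply_symm_apply, ContinuousMulEquiv.apply_symm_apply]; exact hbn

include heA ha ht in
/-- **`(T ∩ Stab(A 0)) ∩ S` IS COMPACT INSIDE ANY SUBGROUP `S ≥ T ∩ Stab(A 0)`** (as a subset of `↥S`; ★ B-1 `isCompact_cmBorelTriple_M_inf` through the embedding `↥S ↪ Γ`) — the
`hC` letter of ★ (α) with `C i := (T ∩ Stab(A 0)).subgroupOf (T i)`. [cite: BruhatTits1972, §10] -/
theorem isCompact_subgroupOf_M_inf (P₀ : Subgroup (Gqs L v))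
    (x₀ : {M : Submodule 𝒪[(w.1.adicCompletion L)] (Fin 3 → (w.1.adicCompletion L)) //
      IsVertex (galAdicCompletionMap (L := L) (IsCMField.complexConj L) hw) ϖ ((StdForm.antidiagonal 3).over (w.1.adicCompletion L)) M})
    (hP₀ : ∀ g, g ∈ P₀ ↔ a g x₀ = x₀) (S : Subgroup (Gqs L v)) (hS : t.M ⊓ P₀ ≤ S) :
    IsCompact (((t.M ⊓ P₀).subgroupOf S : Subgroup ↥S) : Set ↥S) := by
  refine Topology.IsEmbedding.subtypeVal.isCompact_iff.2 ?_
  have hset : ((↑) : ↥S → Gqs L v) '' (((t.M ⊓ P₀).subgroupOf S : Subgroup ↥S) : Set ↥S) = ((t.M ⊓ P₀ : Subgroup (Gqs L v)) : Set (Gqs L v)) := by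
    ext g
    constructor
    · rintro ⟨x, hx, rfl⟩; exact hx
    · intro hg; exact ⟨⟨g, hS hg⟩, hg, rfl⟩
  rw [hset]
  subst ht
  exact isCompact_cmBorelTriple_M_inf L v w hw eA heA ha P₀ x₀ hP₀

include hd heA ha hA0 hA1 ht hτM hτA in
set_option maxHeartbeats 1600000 in  -- the datum vertex type (41g-H ∕ 48-datum `whnf` wall)
/-- **(X3∕X4) THE (α) PACKAGE AT A SPECIAL VERTEX `A m`, `m ∈ {0,1}`** (`ι := Unit`, `g := 1`, `H := B = t.P`, `K := Stab(A m)`, `T () := B ⊓ K`,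
`C () := (T ∩ Stab(A 0)).subgroupOf (B ⊓ K)`, `N () := t.N.subgroupOf (B ⊓ K)`): the binders `hcover hdisj hT hdec hC` of ★ `Representation.finrank_intertwiningMap_smoothIndRep_eq_sum_finrank_eigen`
at the datum, token for token after that instantiation. [cite: BruhatTits1972, (4.4.3)–(4.4.4) and §10] [cite: Rogawski1990, §1.10 p. 9; §4.5 p. 45] [cite: SchneiderStuhler1997, §III.4] -/
theorem borelDoubleCoset_vertex {m : ℤ} (hm : m = 0 ∨ m = 1) (P₀ Pm : Subgroup (Gqs L v)) (hP₀ : ∀ g, g ∈ P₀ ↔ a g (A 0) = A 0) (hPm : ∀ g, g ∈ Pm ↔ a g (A m) = A m) :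
    (∀ y : Gqs L v, ∃ _ : Unit, ∃ h : ↥t.P, ∃ κ ∈ Pm, y = (h : Gqs L v) * 1 * κ) ∧
    (∀ i j : Unit, (∃ h : ↥t.P, ∃ κ ∈ Pm, (1 : Gqs L v) = (h : Gqs L v) * 1 * κ) → i = j) ∧
    (∀ (_ : Unit) (y : Gqs L v), y ∈ t.P ⊓ Pm ↔ y ∈ t.P ∧ (1 : Gqs L v)⁻¹ * y * 1 ∈ Pm) ∧
    (∀ (_ : Unit) (x : ↥(t.P ⊓ Pm)), ∃ c ∈ (t.M ⊓ P₀).subgroupOf (t.P ⊓ Pm), ∃ n ∈ t.N.subgroupOf (t.P ⊓ Pm), x = c * n) ∧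
    (∀ _ : Unit, IsCompact (((t.M ⊓ P₀).subgroupOf (t.P ⊓ Pm) : Subgroup ↥(t.P ⊓ Pm)) : Set ↥(t.P ⊓ Pm))) := by
  refine ⟨fun y => ?_, fun _ _ _ => Subsingleton.elim _ _, fun _ y => by rw [Subgroup.mem_inf, inv_one, one_mul, mul_one], fun _ x => ?_, fun _ => ?_⟩
  · obtain ⟨h, hh, κ, hκ, hy⟩ := exists_mem_P_mul_of_apply_apartmentEnum L v w hw hd eA heA ha A hA0 hA1 t ht τM hτM hτA hm Pm hPm y
    exact ⟨(), ⟨h, hh⟩, κ, hκ, by rw [mul_one]; exact hy⟩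
  · obtain ⟨c, n, hcM, hcA, hnN, hnA, hx⟩ :=
      exists_torus_mul_unipotent_of_mem_P_of_apply_apartmentEnum L v w hw hd eA heA ha A hA0 hA1 t ht (Subgroup.mem_inf.1 x.2).1 ((hPm x).1 (Subgroup.mem_inf.1 x.2).2)
    have htP : t.M ≤ t.P := t.M_le
    have hNP : t.N ≤ t.P := t.N_le
    refine ⟨⟨c, Subgroup.mem_inf.2 ⟨htP hcM, (hPm c).2 (hcA m)⟩⟩, Subgroup.mem_subgroupOf.2 (Subgroup.mem_inf.2 ⟨hcM, (hP₀ c).2 (hcA 0)⟩),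
      ⟨n, Subgroup.mem_inf.2 ⟨hNP hnN, (hPm n).2 hnA⟩⟩, Subgroup.mem_subgroupOf.2 hnN, Subtype.ext hx⟩
  · refine isCompact_subgroupOf_M_inf L v w hw eA heA ha t ht P₀ (A 0) hP₀ _ fun c hc => Subgroup.mem_inf.2 ⟨t.M_le (Subgroup.mem_inf.1 hc).1, (hPm c).2 ?_⟩
    have hcM : c ∈ (cmBorelTriple L 3 v : ParabolicTriple (Gqs L v)).M := by have h := (Subgroup.mem_inf.1 hc).1; subst ht; exact h
    exact apartmentEnum_eq_self_of_mem_cmBorelTriple_M_of_apply_zero L v w hw hd eA heA ha A hA0 hA1 hcM ((hP₀ c).1 (Subgroup.mem_inf.1 hc).2) m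


/-! ### ED. 2 (append-only behind p853535): the three DOCKING one-liners `hCM ∕ hCT ∕ hr` of the generic consumer (61-G `…_block_eigen_zeroChains`) at the two vertex packages -/

include hd heA ha hA0 hA1 ht in
set_option maxHeartbeats 1600000 in  -- the datum vertex type (statement `whnf` on the CM carriers)
/-- **DOCKING ONE-LINERS FOR THE VERTEX PACKAGES** in the shapes of the generic consumer (61-G `…_block_eigen_zeroChains`: `(C : Subgroup Γ) (hCM : C ≤ t.M)
(hCT : ∀ i, C ≤ T i)` and `(hr : ∀ i, a (g i) x₀ ∈ R₀)`), at `C := t.M ⊓ P₀`, `g := 1`, `T := t.P ⊓ Pm`, `x₀ := A m`, `R₀ := Set.range A` (★ B-2's vertex representatives):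
`T ∩ Stab(A 0) ≤ T`; `T ∩ Stab(A 0) ≤ B ∩ Stab(A m)` (a torus element fixing `A 0` fixes the apartment pointwise, ★ B-1); `1 · A m = A m ∈ 𝒜`.  Valid for every `m : ℤ`
(used at `m = 0, 1`). [cite: BruhatTits1972, §10] [cite: Serre1980Trees, II.1.1] -/
theorem borelDoubleCoset_vertex_dock (m : ℤ) (P₀ Pm : Subgroup (Gqs L v)) (hP₀ : ∀ g, g ∈ P₀ ↔ a g (A 0) = A 0) (hPm : ∀ g, g ∈ Pm ↔ a g (A m) = A m) :
    ((t.M ⊓ P₀ : Subgroup (Gqs L v)) ≤ t.M) ∧ ((t.M ⊓ P₀ : Subgroup (Gqs L v)) ≤ t.P ⊓ Pm) ∧ (a 1 (A m) ∈ Set.range A) := by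
  refine ⟨inf_le_left, fun c hc => Subgroup.mem_inf.2 ⟨t.M_le (Subgroup.mem_inf.1 hc).1, (hPm c).2 ?_⟩, ⟨m, (actionHom_one_apply L v w hw eA ha (A m)).symm⟩⟩
  have hcM : c ∈ (cmBorelTriple L 3 v : ParabolicTriple (Gqs L v)).M := by have h := (Subgroup.mem_inf.1 hc).1; subst ht; exact h
  exact apartmentEnum_eq_self_of_mem_cmBorelTriple_M_of_apply_zero L v w hw hd eA heA ha A hA0 hA1 hcM ((hP₀ c).1 (Subgroup.mem_inf.1 hc).2) m

end DoubleCoset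

end Summit.HodgeConjecture.HodgeConjecture.Cruxes.H413.F0P3cStCharTSHorocyclesAtDatum

end
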